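import Summits.Schanuel.Schanuel.Theorems.DiophantineDichotomyKhovanskiiApproxTypeEvIffStubs
import Summits.Schanuel.Schanuel.Theorems.DiophantineDichotomyKhovanskiiApproxTypeEvLogBarrier
import Summits.Schanuel.Schanuel.Theorems.DiophantineDichotomyKhovanskiiApproxTypeEvAnchoredRoute
import HarnessLib

/-!
# Crux `KhovanskiiApproxTypeEv` (stmt-Schanuel-14972): the crux AS FILED implies four catalogued
# open problems — one-name certificate (line `anchored-reduction`, lead c4)

Route `DiophantineDichotomy`, crux `Summit.Schanuel.Schanuel.Theses.DiophantineDichotomy.KhovanskiiApproxTypeEv`.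
This file composes, BY NAME, results already landed by the line (`--supports stmt-Schanuel-14972`):
the equivalence of the crux with the conjunction of the skeleton's two open stubs
(`khovanskiiApproxTypeEv_iff_stubs`, p125111: `evNonLWTwo_of_ev`, `evRankThreeUp_of_ev`) and the
unconditional hardness certificates of those stubs (p124086 `expOnePiAlgebraicIndependent_of_evNonLWTwo`;
p124970 `algebraicIndependent_piI_log_two_of_evNonLWTwo`, `algebraicIndependent_log_two_log_three_of_evNonLWTwo`,
`two_le_trdeg_logs_of_evRankThreeUp`).  The result is the single statement a planner restating the
crux needs to cite: **any Lean proof of `KhovanskiiApproxTypeEv` is at once a Lean proof of**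
(1) the algebraic independence of `e` and `π` (`ExpOnePiAlgebraicIndependent`, open),
(2) that of `πi` and `log 2`, (3) that of `log 2` and `log 3`, and (4) `trdeg_ℚ ℚ(log 2, log 3, 2πi) ≥ 2`
— (2)–(4) are printed-open instances of the catalogued barrier
`Literature.Barriers.Schanuel.AlgebraicIndependenceOfLogarithms` (Roy 1992: "it is not even known
whether or not there exist two elements of `L` which are algebraically independent over `ℚ`").
All four implications are UNCONDITIONAL (level-one race with the PROVED `approximationPropertyDegOne_proof`).

Nothing new is asserted; no `def`; sorry-free; axioms standard.
-/

noncomputable section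

set_option linter.dupNamespace false

namespace Summit.Schanuel.Schanuel.Cruxes.KhovanskiiApproxTypeEv.AnchoredReduction

open Summit.Schanuel.Schanuel.Theses.DiophantineDichotomy (KhovanskiiApproxTypeEv)

/-- **Registered sub-goal `barriers_of_khovanskiiApproxTypeEv` — the crux as filed proves four open
problems.**  `KhovanskiiApproxTypeEv` (eventual simultaneous approximation type `a < 1/(n−1)` at EVERY
free Khovanskii point of rank `n ≥ 2`) implies, unconditionally in the tree:
`ExpOnePiAlgebraicIndependent` (`e ⊥ π`), `AlgebraicIndependent ℚ ![πi, log 2]`,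
`AlgebraicIndependent ℚ ![log 2, log 3]`, and `2 ≤ trdeg_ℚ ℚ(log 2, log 3, 2πi)`.  Composition of
`evNonLWTwo_of_ev` / `evRankThreeUp_of_ev` (p125111) with the landed certificates of stubs 6 and 7
(p124086, p124970). [folklore] -/
theorem barriers_of_khovanskiiApproxTypeEv : KhovanskiiApproxTypeEv →
    Literature.NumberTheory.Transcendental.ExpOnePiAlgebraicIndependent ∧
    AlgebraicIndependent ℚ ![(Real.pi : ℂ) * Complex.I, (Real.log 2 : ℂ)] ∧
    AlgebraicIndependent ℚ ![(Real.log 2 : ℂ), (Real.log 3 : ℂ)] ∧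
    (2 : Cardinal) ≤ Algebra.trdeg ℚ
      ↥(IntermediateField.adjoin ℚ
        (Set.range ![(Real.log 2 : ℂ), (Real.log 3 : ℂ), 2 * Real.pi * Complex.I])) :=
  fun hEv =>
    ⟨expOnePiAlgebraicIndependent_of_evNonLWTwo (evNonLWTwo_of_ev hEv),
      algebraicIndependent_piI_log_two_of_evNonLWTwo (evNonLWTwo_of_ev hEv),
      algebraicIndependent_log_two_log_three_of_evNonLWTwo (evNonLWTwo_of_ev hEv),
      two_le_trdeg_logs_of_evRankThreeUp (evRankThreeUp_of_ev hEv)⟩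

/-! ## Even the minimal restatement is open-problem-grade: the ANCHORED crux

Appended by the lead c4 (append protocol; the declaration above is byte-identical).  The anchored
reduction (`reductionAnchored`, p124086) lets the route consume the crux only on the anchored family
`s = (1, iπ, s₂, …)` (`KhovanskiiApproxTypeEvAnchored`).  A planner restating the crux to that family
must know what it still contains: the flagship `EPiSimultaneousTypeEv` (route item stmt-Schanuel-14975,
hence `e ⊥ π` by the proved level-one race) and, at the anchored log point `(1, iπ, log 2)`, an
algebraic independence inside `{e, π, log 2}` — both open.  So restating to the anchored family is
HONEST and MINIMAL for the route but does not make the item provable with anything in print. -/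

open Summit.Schanuel.Schanuel.Theses.DiophantineDichotomy (EPiSimultaneousTypeEv)
open Summit.Schanuel.Schanuel.Theorems
open Complex

/-- **Registered sub-goal `flagship_of_evAnchored`.**  The anchored crux `KhovanskiiApproxTypeEvAnchored`
contains the flagship `EPiSimultaneousTypeEv` (stmt-Schanuel-14975): its `n = 0` layer is the single
free Khovanskii point `(1, iπ)` (`flagship_of_evAt_anchor`, p112678). [folklore] -/
theorem flagship_of_evAnchored (hA : KhovanskiiApproxTypeEvAnchored) : EPiSimultaneousTypeEv := by
  obtain ⟨a, b, C, ha, hM⟩ := hA 0 ![(1 : ℂ), I * Real.pi] (by simp) (by simp)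
    EPiSimultaneousType.linearIndependent_one_I_pi EPiSimultaneousType.khovanskiiSystem_one_I_pi
  have ha1 : a < 1 := ha.trans_le (by norm_num)
  exact flagship_of_evAt_anchor ha1 hM

/-- **Registered sub-goal `barriers_of_evAnchored` — the anchored crux proves `e ⊥ π` and an algebraic
independence inside `{e, π, log 2}`.**  `KhovanskiiApproxTypeEvAnchored` implies, unconditionally in the
tree, `ExpOnePiAlgebraicIndependent` (flagship + `approximationPropertyDegOne_proof` +
`ePiRaceEv_proof`) and `2 ≤ trdeg_ℚ ℚ(1, iπ, log 2, e, e^{iπ}, e^{log 2}) (= trdeg_ℚ ℚ(e, π, log 2))`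
(level-one race `two_le_trdeg_of_approxTypeEvAt` at the anchored free Khovanskii point `(1, iπ, log 2)`
of rank 3, p124730) — no algebraic independence result is known inside `{e, π, log 2}`. [folklore] -/
theorem barriers_of_evAnchored : KhovanskiiApproxTypeEvAnchored →
    Literature.NumberTheory.Transcendental.ExpOnePiAlgebraicIndependent ∧
    (2 : Cardinal) ≤ Algebra.trdeg ℚ
      ↥(IntermediateField.adjoin ℚ (Set.range ![(1 : ℂ), I * Real.pi, ((Real.log 2 : ℝ) : ℂ)] ∪
        Set.range (Complex.exp ∘ ![(1 : ℂ), I * Real.pi, ((Real.log 2 : ℝ) : ℂ)]))) := by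
  intro hA
  refine ⟨expOnePiAlgebraicIndependent_of_degOne_of_epiSimultaneousTypeEv
    approximationPropertyDegOne_proof (flagship_of_evAnchored hA), ?_⟩
  obtain ⟨a, b, C, ha, hM⟩ := hA 1 ![(1 : ℂ), I * Real.pi, ((Real.log 2 : ℝ) : ℂ)] (by simp) (by simp)
    linearIndependent_onePiLogTwo isFreeKhovanskii_onePiLogTwo
  have ha1 : a < 1 := ha.trans_le (by norm_num)
  exact two_le_trdeg_of_approxTypeEvAt (by norm_num) linearIndependent_onePiLogTwo ha1 hM

end Summit.Schanuel.Schanuel.Cruxes.KhovanskiiApproxTypeEv.AnchoredReduction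

end
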